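import Summits.QuantumFields.BalabanUV.T4Continuum.Support.VariationalColourFederbush
import Summits.QuantumFields.BalabanUV.T4Continuum.Support.VariationalCovariantTower

/-!
# T⁴ programme, spine node NE2 (U1a), lane P2 — SUPPLIER ITEM (O8) «V-COL-COMP»: COMPOSITE TRANSPORTED AVERAGES AND THE TRANSPORT OF
# THE COLOUR DIRICHLET SUMS ALONG THE BLOCK NESTING, for 0-forms with values in a normed ℂ-space `E` (the colour re-run of the
# carrier part §1–§2 of `VariationalCovariantTower` p213109)

NE2 formalisation swarm `b2b-balaban-t4-ne2-formalise-*`, leaf prover 02 (gen 4); P2 skeleton `t4/skeletons/NE2-t4-ne2-p2.md` v0.10 §2.E rows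
V-COL ∕ V-COMP (0-form part).  Carriers: `VariationalColourFederbush.Qcv ∕ cDv ∕ dirUv`; the tree's two-level reindexing `B5Composition116.sites ∕
bpt_bpt ∕ sum_J` and `VariationalTower.sites_unitVec` BY NAME.
 * `compTv T T′ x := T(block of x) ∘ T′(x)` (composite site operators on the `n·L`-fine torus, a product in `E →L[ℂ] E`), unitary if both are
   (`compTv_mem_unitary`);
 * **`Qcv_comp_Qcv_apply`**: `(Qcv n M T ∘ Qcv L (fine n M) T′) f′ = Qcv (n·L) M (compTv T T′) (f′ ∘ sites)` — COMP⁺ in colour, no commutativity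
   (the scalar proof's `ring` is replaced by `map_sum`∕`map_smul`∕`mul_apply`);
 * `Rtrv`, `dirUv_transport`, `sum_norm_sq_transport`: the fine objects read on the `n·L`-fine torus have the same Dirichlet sums and masses.
HONEST FRAMING (T4-DAG p. 1).  Model level (operators DATA); [folklore] reindexing; nothing printed is a hypothesis; no `def … : Prop`; no
`sorry`.  NE2 NOT proved; spine PROVED 0∕9; rung (B)+1 finite T⁴ — NOT infinite volume, NOT a mass gap, NOT Clay.  HONEST DEPENDENCY (cell,
verbatim): continuum YM on T⁴ ⇐ BetaPertH ∧ nine spine estimates (0/9 proved); BetaPertH ⇐ (D1) ∧ (D4) ∧ CAP+tail; G-an2-4 gates asym, D1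
and NE2/3/4.
-/

noncomputable section

namespace Summit.QuantumFields.BalabanUV.T4Continuum.VariationalColourTower

open Finset
open Literature.MathematicalPhysics.QuantumFieldTheory.Balaban1983to89
open Literature.MathematicalPhysics.QuantumFieldTheory.Balaban1983to89.B5Prop11Plancherel (Tor fine unitVec)
open Literature.MathematicalPhysics.QuantumFieldTheory.Balaban1983to89.B5Block118 (bpt)
open Literature.MathematicalPhysics.QuantumFieldTheory.Balaban1983to89.B5Blocks16 (blockOf blockOf_bpt)
open Literature.MathematicalPhysics.QuantumFieldTheory.Balaban1983to89.B5Composition116 (sites bpt_bpt sum_J J fine_fine recast_add)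
open Summit.QuantumFields.BalabanUV.T4Continuum.VariationalTower (sites_unitVec)
open Summit.QuantumFields.BalabanUV.T4Continuum.VariationalCovariantTower (sites_add)
open Summit.QuantumFields.BalabanUV.T4Continuum.VariationalColourFederbush (cDv dirUv Qcv)

variable {d : ℕ} {E : Type*} [NormedAddCommGroup E] [NormedSpace ℂ E]
variable (n L : ℕ) [NeZero n] [NeZero L] (M : Fin d → ℕ) [hM : ∀ μ, NeZero (M μ)]

/-! ## §1 COMP⁺ in colour: the composite transported average -/

/-- the COMPOSITE site operators `T″(x′) = T(block of x′) ∘ T′(x′)` on the `n·L`-fine torus, read through `sites`. [folklore] -/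
def compTv (T : Tor (fine n M) → (E →L[ℂ] E)) (T' : Tor (fine L (fine n M)) → (E →L[ℂ] E)) (x : Tor (fine (n * L) M)) : E →L[ℂ] E :=
  T (blockOf L (fine n M) (sites n L M x)) * T' (sites n L M x)

/-- composites of contractions are contractions. [folklore] -/
theorem norm_compTv_le_one {T : Tor (fine n M) → (E →L[ℂ] E)} {T' : Tor (fine L (fine n M)) → (E →L[ℂ] E)}
    (hT : ∀ x, ‖T x‖ ≤ 1) (hT' : ∀ x, ‖T' x‖ ≤ 1) (x : Tor (fine (n * L) M)) : ‖compTv n L M T T' x‖ ≤ 1 :=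
  (norm_mul_le _ _).trans (by nlinarith [hT (blockOf L (fine n M) (sites n L M x)), hT' (sites n L M x), norm_nonneg (T' (sites n L M x))])

/-- composites of unitary site operators (on a Hilbert space) are unitary. [folklore] -/
theorem compTv_mem_unitary {H : Type*} [NormedAddCommGroup H] [InnerProductSpace ℂ H] [CompleteSpace H]
    {T : Tor (fine n M) → (H →L[ℂ] H)} {T' : Tor (fine L (fine n M)) → (H →L[ℂ] H)}
    (hT : ∀ x, T x ∈ unitary (H →L[ℂ] H)) (hT' : ∀ x, T' x ∈ unitary (H →L[ℂ] H)) (x : Tor (fine (n * L) M)) :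
    compTv n L M T T' x ∈ unitary (H →L[ℂ] H) :=
  mul_mem (hT _) (hT' _)

/-- **COMP⁺ (colour)**: `(Q_T ∘ Q_{T′}) f′ = Q_{T″} (f′ ∘ sites)` — averaging the one-step transported averages over the `n`-blocks is the
`n·L`-block transported average with the composite operators (tree `bpt_bpt`∕`sum_J`; linearity, no commutativity). [folklore] -/
theorem Qcv_comp_Qcv_apply (T : Tor (fine n M) → (E →L[ℂ] E)) (T' : Tor (fine L (fine n M)) → (E →L[ℂ] E))
    (f' : Tor (fine L (fine n M)) → E) :
    (Qcv n M T ∘ Qcv L (fine n M) T') f' = Qcv (n * L) M (compTv n L M T T') (f' ∘ sites n L M) := by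
  funext z
  simp only [Function.comp_apply, Qcv]
  rw [← sum_J n L (fun Jx => compTv n L M T T' (bpt (n * L) M z Jx) (f' (sites n L M (bpt (n * L) M z Jx))))]
  simp_rw [compTv, ← bpt_bpt, blockOf_bpt, map_smul, map_sum, mul_apply_eq_comp]
  have hscal : (((n * L : ℕ) : ℂ) ^ d)⁻¹ = ((n : ℂ) ^ d)⁻¹ * ((L : ℂ) ^ d)⁻¹ := by
    push_cast; rw [mul_pow, mul_inv]
  rw [hscal, mul_smul]
  simp only [smul_sum]

/-- COMP⁺ as an identity of maps. [folklore] -/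
theorem Qcv_comp_Qcv_eq (T : Tor (fine n M) → (E →L[ℂ] E)) (T' : Tor (fine L (fine n M)) → (E →L[ℂ] E)) :
    Qcv n M T ∘ Qcv L (fine n M) T' = fun f' => Qcv (n * L) M (compTv n L M T T') (f' ∘ sites n L M) :=
  funext (Qcv_comp_Qcv_apply n L M T T')

/-! ## §2 Transport of the fine objects along the block nesting `sites` -/

/-- the fine bond operators read on the `n·L`-fine torus. [folklore] -/
def Rtrv (R' : Tor (fine L (fine n M)) → Fin d → (E →L[ℂ] E)) (x : Tor (fine (n * L) M)) (μ : Fin d) : E →L[ℂ] E :=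
  R' (sites n L M x) μ

/-- the colour Dirichlet sums are transported: `dirUv_{n·L}(R′∘sites)(f′∘sites) = dirUv(R′)(f′)`. [folklore] -/
theorem dirUv_transport (R' : Tor (fine L (fine n M)) → Fin d → (E →L[ℂ] E)) (f' : Tor (fine L (fine n M)) → E) (μ : Fin d) :
    dirUv (fine (n * L) M) (Rtrv n L M R') (f' ∘ sites n L M) μ = dirUv (fine L (fine n M)) R' f' μ := by
  unfold dirUv cDv Rtrv
  simp_rw [Function.comp_apply, sites_add, sites_unitVec]
  exact Equiv.sum_comp (sites n L M) (fun y => ‖R' y μ (f' (y + unitVec (fine L (fine n M)) μ)) - f' y‖ ^ 2)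

omit [NormedSpace ℂ E] in
/-- the `ℓ²` masses are transported. [folklore] -/
theorem sum_norm_sq_transport (f' : Tor (fine L (fine n M)) → E) : ∑ x, ‖(f' ∘ sites n L M) x‖ ^ 2 = ∑ y, ‖f' y‖ ^ 2 :=
  Equiv.sum_comp (sites n L M) (fun y => ‖f' y‖ ^ 2)

omit [NormedAddCommGroup E] [NormedSpace ℂ E] [NeZero n] [NeZero L] hM in
/-- `(g ∘ sites⁻¹) ∘ sites = g`. [folklore] -/
theorem comp_symm_comp (g : Tor (fine (n * L) M) → E) : (g ∘ (sites n L M).symm) ∘ sites n L M = g := by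
  funext x; simp

/-- COMP⁺ read backwards: the `n·L`-level average with composite operators of ANY field `g` is the two-step average of `g ∘ sites⁻¹`. [folklore] -/
theorem Qcv_compTv_eq_comp (T : Tor (fine n M) → (E →L[ℂ] E)) (T' : Tor (fine L (fine n M)) → (E →L[ℂ] E)) (g : Tor (fine (n * L) M) → E) :
    Qcv (n * L) M (compTv n L M T T') g = Qcv n M T (Qcv L (fine n M) T' (g ∘ (sites n L M).symm)) := by
  have h := Qcv_comp_Qcv_apply n L M T T' (g ∘ (sites n L M).symm)
  rw [comp_symm_comp] at h
  exact h.symm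

end Summit.QuantumFields.BalabanUV.T4Continuum.VariationalColourTower

end
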